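import Mathlib
import Summits.KontsevichZagierPeriods.KontsevichZagierPeriods.Theorems.SoloInformedFormalPeriodRing
import HarnessLib
import HarnessLib.Audit

/-!
# SoloInformed — Proposition VI-bis: in every diagonalizable model, FULL^eff ⟺ EFF-INJ ⟺
# `per` is a non-zero-divisor ⟺ cancellation of `𝕃` in the monoid of simple objects

The model of Proposition VI (`SoloInformedEffectiveModel.lean`) is one instance of a general,
kernel-checked equivalence.  For ANY commutative monoid `G` of degrees (the character monoid of a
diagonalizable monoid scheme `M = Spec ℚ[G]`; `𝒞_G` = the skeleton of `Rep_ℚ(M)` = `G`-graded spaces,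
`SoloInformedFormalPeriodModel.lean`) and any degree `χ ∈ G` (`𝕃 := 𝕃_χ = line χ`, the would-be
Lefschetz object), the following are EQUIVALENT (`diagonalCancellation_tfae`):

1. `χ` is cancellable in `G`: `a + χ = b + χ → a = b` (`IsAddRegular χ`) — cancellation of `𝕃` in the
   monoid `(simple objects of C^eff, ⊗)`, the semisimple shadow of Voevodsky's cancellation theorem;
2. FULL: the functor `− ⊗ 𝕃` on `C^eff = 𝒞_G` is full (`TensorLineFull χ`);
3. `per(𝕃) = p_χ` is a NON-ZERO-DIVISOR of the ring of formal periods `P̃(C^eff) = ℚ[G]`;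
4. EFF-INJ: `P̃(C^eff) → P̃(C^eff[𝕃⁻¹]) = P̃(𝒞_{G[−χ]})` is injective, where `G → G[−χ]` is the
   localisation of the monoid `G` at `χ` (`AddLocalization (multiples χ)`), i.e. `C^eff[𝕃⁻¹] = 𝒞_{G[−χ]}`.

None of 1–4 mentions the comparison point `c` or the Period Conjecture: in the diagonalizable world the
residual conjunct (FULL^eff / EFF-INJ / `KZ.PiCancellation` in the dictionary of Proposition V of the
paper) is EXACTLY a cancellation statement about `𝕃` in the additive monoid of isomorphism classes, and
is logically independent of PC for the localised category (Proposition VI: `G = E = {𝟙, U, χⁿ}`,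
`U + χ = 𝟙 + χ`, not cancellable; the dense model `G = ℕ`, cancellable — `diagonalCancellation_nat`).

References: A. Huber, G. Wüstholz, *Transcendence and linear relations of 1-periods* (2022), Prop. 7.17,
App. A.3; V. Voevodsky, *Cancellation theorem*, Doc. Math. Extra vol. Suslin (2010) 671–685; J. Ayoub,
*Nouvelles cohomologies de Weil en caractéristique positive*, Algebra Number Theory 14 (2020), Rem. 1.3.
-/

noncomputable section

open scoped BigOperators nonZeroDivisors

namespace Summit.KontsevichZagierPeriods.KontsevichZagierPeriods.Theorems

namespace SoloInformedGrObj

variable {G : Type}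

open AddMonoidAlgebra

/-! ### Morphisms are their matrices -/

/-- Extensionality for morphisms of `𝒞_G`. -/
theorem Hom.ext' {X Y : SoloInformedGrObj G} {f g : Hom X Y} (h : f.mat = g.mat) : f = g := by
  cases f; cases g; cases h; rfl

variable [AddCommMonoid G]

/-! ### 2. The functor `− ⊗ 𝕃_χ` and its fullness -/

/-- `− ⊗ 𝕃_χ` on morphisms (`𝕃_χ := line χ`): the same matrix, degrees shifted by `χ`. -/
def tensorLineHom (χ : G) {X Y : SoloInformedGrObj G} (f : Hom X Y) :
    Hom (tensor X (line χ)) (tensor Y (line χ)) where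
  mat y x := f.mat y.1 x.1
  graded y x hne := f.graded y.1 x.1 fun e => hne (by simp [e])

/-- The matrix of `f ⊗ 𝕃_χ`. -/
@[simp] theorem tensorLineHom_mat (χ : G) {X Y : SoloInformedGrObj G} (f : Hom X Y)
    (y : Y.B × Unit) (x : X.B × Unit) : (tensorLineHom χ f).mat y x = f.mat y.1 x.1 := rfl

/-- `− ⊗ 𝕃_χ` is faithful (always). -/
theorem tensorLineHom_injective (χ : G) (X Y : SoloInformedGrObj G) :
    Function.Injective (tensorLineHom χ (X := X) (Y := Y)) := by
  intro f g e
  apply Hom.ext'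
  funext y x
  have := congrArg (fun k => k.mat (y, ()) (x, ())) e
  simpa using this

/-- FULL: the functor `− ⊗ 𝕃_χ : 𝒞_G → 𝒞_G` is full. -/
def TensorLineFull (χ : G) : Prop :=
  ∀ X Y : SoloInformedGrObj G, Function.Surjective (tensorLineHom χ (X := X) (Y := Y))

/-- `− ⊗ 𝕃_χ` is full iff `χ` is cancellable.  (⇒: for `a + χ = b + χ` the identity matrix is a
morphism `𝕃_a ⊗ 𝕃_χ → 𝕃_b ⊗ 𝕃_χ`, and a preimage `𝕃_a → 𝕃_b` with entry `1` forces `a = b`;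
⇐: a graded matrix for the shifted degrees is graded for the original ones.) -/
theorem tensorLineFull_iff (χ : G) : TensorLineFull χ ↔ IsAddRegular χ := by
  constructor
  · intro hfull
    have hr : IsAddRightRegular χ := by
      intro a b hab
      have hab' : a + χ = b + χ := hab
      let g : Hom (tensor (line a) (line χ)) (tensor (line b) (line χ)) :=
        { mat := fun _ _ => 1
          graded := fun _ _ hne => (hne hab'.symm).elim }
      obtain ⟨f, hf⟩ := hfull (line a) (line b) g
      have h1 : f.mat () () = 1 := by
        have := congrArg (fun k => k.mat ((), ()) ((), ())) hf
        simpa using this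
      by_contra hne
      have h0 : f.mat () () = 0 := f.graded () () fun e => hne (Eq.symm e)
      exact one_ne_zero (h1.symm.trans h0)
    exact ⟨fun a b h => hr ((add_comm χ a).symm.trans (h.trans (add_comm χ b))), hr⟩
  · intro hreg X Y g
    refine ⟨{ mat := fun y x => g.mat (y, ()) (x, ())
              graded := fun y x hne => g.graded (y, ()) (x, ()) fun e => hne (hreg.right e) }, ?_⟩
    apply Hom.ext'
    funext y x
    rfl

/-! ### 3. `per = p_χ` as a (non-)zero-divisor of `P̃(𝒞_G) = ℚ[G]` -/

/-- A failure of cancellation is a zero-divisor relation: `(p_a − p_b) · p_χ = 0`. -/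
theorem gen_sub_gen_mul_gen {a b χ : G} (h : a + χ = b + χ) : (gen a - gen b) * gen χ = 0 := by
  rw [sub_mul, ← gen_add, ← gen_add, h, sub_self]

/-- `p_a ≠ p_b` for `a ≠ b`. -/
theorem gen_sub_gen_ne_zero {a b : G} (h : a ≠ b) : gen a - gen b ≠ (0 : FP G) :=
  fun e => h (gen_injective (sub_eq_zero.1 e))

/-- `p_χ` is a non-zero-divisor of `P̃(𝒞_G)` iff `χ` is cancellable. -/
theorem gen_mem_nonZeroDivisors_iff (χ : G) : gen χ ∈ (FP G)⁰ ↔ IsAddRegular χ := by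
  constructor
  · intro hχ
    have hr : IsAddRightRegular χ := by
      intro a b hab
      by_contra hne
      exact gen_sub_gen_ne_zero hne
        ((mem_nonZeroDivisors_iff_right.1 hχ) _ (gen_sub_gen_mul_gen hab))
    exact ⟨fun a b h => hr ((add_comm χ a).symm.trans (h.trans (add_comm χ b))), hr⟩
  · intro hreg
    refine mem_nonZeroDivisors_iff_right.2 fun x hx => ?_
    have e := congrArg fpEquiv hx
    rw [fpEquiv_mul, fpEquiv_gen, map_zero] at e
    have hz : fpEquiv x = 0 := by
      rw [← AddMonoidAlgebra.coeff_eq_zero]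
      ext a
      have ha := congrArg (fun y : AddMonoidAlgebra ℚ G => y.coeff (a + χ)) e
      simp only [AddMonoidAlgebra.coeff_zero, Finsupp.coe_zero, Pi.zero_apply] at ha
      rw [AddMonoidAlgebra.coeff_mul_single_eq_coeff_mul a
        (fun m _ => ⟨fun h => hreg.right h, fun h => h ▸ rfl⟩), mul_one] at ha
      simpa using ha
    simpa using congrArg fpEquiv.symm hz

/-! ### 4. The localisation `C^eff → C^eff[𝕃_χ⁻¹] = 𝒞_{G[−χ]}` on formal periods -/

variable {G' : Type} [AddCommMonoid G']

/-- `P̃(h_*)` is injective iff `h` is (the `p_g` are a basis). -/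
theorem fpMap_injective_iff (h : G →+ G') :
    Function.Injective (fpMap h) ↔ Function.Injective h := by
  refine ⟨fun hinj a b e => gen_injective (hinj ?_), fpMap_injective h⟩
  rw [fpMap_gen, fpMap_gen, e]

/-- The localisation of the degree monoid at `χ`: `G → G[−χ]`. -/
def locMap (χ : G) : G →+ AddLocalization (AddSubmonoid.multiples χ) :=
  (AddLocalization.addMonoidOf (AddSubmonoid.multiples χ)).toAddMonoidHom

/-- `G → G[−χ]` is injective iff `χ` is cancellable. -/
theorem locMap_injective_iff (χ : G) : Function.Injective (locMap χ) ↔ IsAddRegular χ := by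
  have key := AddSubmonoid.LocalizationMap.injective_iff
    (AddLocalization.addMonoidOf (AddSubmonoid.multiples χ))
  refine (show Function.Injective (locMap χ) ↔ _ from key).trans ⟨fun H => ?_, fun H x hx => ?_⟩
  · exact H (AddSubmonoid.mem_multiples χ)
  · obtain ⟨n, rfl⟩ := (AddSubmonoid.mem_multiples_iff _ _).1 hx
    exact H.nsmul n

/-- EFF-INJ: `P̃(𝒞_G) → P̃(𝒞_{G[−χ]})` is injective iff `χ` is cancellable. -/
theorem fpMap_locMap_injective_iff (χ : G) :
    Function.Injective (fpMap (locMap χ)) ↔ IsAddRegular χ :=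
  (fpMap_injective_iff _).trans (locMap_injective_iff χ)

/-- `𝕃_χ` becomes invertible in `𝒞_{G[−χ]}`: `P̃(locMap)(p_χ)` is a unit. -/
theorem isUnit_fpMap_locMap_gen (χ : G) : IsUnit (fpMap (locMap χ) (gen χ)) := by
  rw [fpMap_gen]
  obtain ⟨u, hu⟩ := (AddLocalization.addMonoidOf (AddSubmonoid.multiples χ)).map_addUnits
    ⟨χ, AddSubmonoid.mem_multiples χ⟩
  refine isUnit_iff_exists_inv.2 ⟨gen (↑(-u) : AddLocalization (AddSubmonoid.multiples χ)), ?_⟩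
  rw [← gen_add, ← gen_zero_eq_one]
  congr 1
  have : (u : AddLocalization (AddSubmonoid.multiples χ)) = locMap χ χ := hu
  rw [← this, AddUnits.add_neg]

/-! ### The equivalence -/

/-- **Proposition VI-bis.** In the diagonalizable model `C^eff = 𝒞_G`, `𝕃 = 𝕃_χ`:
cancellation of `𝕃` ⟺ `− ⊗ 𝕃` full ⟺ `per(𝕃)` non-zero-divisor of `P̃(C^eff)` ⟺
`P̃(C^eff) → P̃(C^eff[𝕃⁻¹])` injective. -/
theorem diagonalCancellation_tfae (χ : G) :
    List.TFAE [IsAddRegular χ, TensorLineFull χ, gen χ ∈ (FP G)⁰,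
      Function.Injective (fpMap (locMap χ))] := by
  tfae_have 2 ↔ 1 := tensorLineFull_iff χ
  tfae_have 3 ↔ 1 := gen_mem_nonZeroDivisors_iff χ
  tfae_have 4 ↔ 1 := fpMap_locMap_injective_iff χ
  tfae_finish

/-- A non-cancellable `χ` (`u + χ = χ` with `u ≠ 0`, as `U ⊗ 𝕃 ≅ 𝕃` in Proposition VI) kills all four
at once, whatever the comparison point. -/
theorem diagonalCancellation_fails {u χ : G} (hu : u ≠ 0) (h : u + χ = χ) :
    ¬ IsAddRegular χ ∧ ¬ TensorLineFull χ ∧ gen χ ∉ (FP G)⁰ ∧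
      ¬ Function.Injective (fpMap (locMap χ)) := by
  have h1 : ¬ IsAddRegular χ := fun hreg => hu (hreg.right (h.trans (zero_add χ).symm))
  exact ⟨h1, fun H => h1 ((tensorLineFull_iff χ).1 H), fun H => h1 ((gen_mem_nonZeroDivisors_iff χ).1 H),
    fun H => h1 ((fpMap_locMap_injective_iff χ).1 H)⟩

/-- The dense model `G = ℕ` (`C^eff_0 = Rep(𝔸¹, ×)`): every `χ` is cancellable, so all four hold. -/
theorem diagonalCancellation_nat (χ : ℕ) :
    IsAddRegular χ ∧ TensorLineFull χ ∧ gen χ ∈ (FP ℕ)⁰ ∧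
      Function.Injective (fpMap (locMap χ)) := by
  have h1 : IsAddRegular χ := IsAddRegular.all χ
  exact ⟨h1, (tensorLineFull_iff χ).2 h1, (gen_mem_nonZeroDivisors_iff χ).2 h1,
    (fpMap_locMap_injective_iff χ).2 h1⟩

end SoloInformedGrObj

end Summit.KontsevichZagierPeriods.KontsevichZagierPeriods.Theorems
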